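import Literature.Analysis.FluidPDE.ConfinedHardSphereFlowConstruction
import Literature.Analysis.FluidPDE.HardSphereScattering
import HarnessLib

/-!
# Definitions of the proof of `ConfinedHardSphereFlow.nonempty_torus_balls`

The objects used by the layers `ConfinedHardSphereFlow{Orbits,Measurable,Restart,ShortTime,
ShortBad,Scattering,Alexander}` of the proof of the existence of the confined hard-sphere flow on
the torus among fixed round scatterers (Cercignani–Illner–Pulvirenti 1994 Thm. 4.2.1, App. 4.A
p. 111; iteration scheme of Gallagher–Saint-Raymond–Texier 2013, proof of Prop. 4.1.1), gathered
in one file so that the theorem layers are proof-only. All are real definitions with bodies; they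
are the confined twins of the corresponding objects of the wall-free development
(`Alexander.instantSet`, `Alexander.stepMap`, `Alexander.FwdGoodUpTo`, `Alexander.shortGood` and
its pieces, `Alexander.kick`, `Alexander.shortPiece`, `Alexander.iterGood`, `Alexander.windowLoss`),
plus the sphere–scatterer objects: the wall pieces (`wallFar`, `WallOthersFar`, `wallNoHitPiece`,
`wallHitPiece`, `cShortGood`), the one-particle billiard at a round scatterer on the torus
(`wallData`, `wallKickOne`, `wallCollide`, `shiftPos`, `wallKickGood`), the hypotheses of a wall hit
(`WallHitHyp`), the kick `cKick`, `IsNoEventData`, the thin events `wallClose` / `wallBad`, the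
pieces `cShortPiece`, and the iteration sets / constants `iterGood`, `windowLoss`, `windowConst`.

## References

* C. Cercignani, R. Illner, M. Pulvirenti, *The Mathematical Theory of Dilute Gases*, Springer
  (1994), §4.2, Thm. 4.2.1, App. 4.A pp. 107–111.
* I. Gallagher, L. Saint-Raymond, B. Texier, *From Newton to Boltzmann* (2013), §4.1,
  Prop. 4.1.1, Lemma 4.1.2.
-/

open Set Function MeasureTheory Metric
open scoped ENNReal InnerProductSpace

namespace Literature.Analysis.FluidPDE

noncomputable section

section Kinetic

namespace ConfinedAlexander

/-! ## Objects of a general geometry and wall family -/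

section General

variable {d : Type*} [Fintype d] {X : Type*} {N : ℕ} {ι : Type*} {G : Geometry d X} {W : ι → Wall d X} {ε : ℝ}

variable (G W ε) in
/-- The event instants of the forward dynamics from `y` as a set of real times: the finite `t_k`
with `k ≥ 1`. [folklore] -/
def instantSet (y : Config N d X) : Set ℝ :=
  {u | 0 ≤ u ∧ ∃ k, 0 < k ∧ eventInstant G W ε y k = ENNReal.ofReal u}

/-- Membership in `instantSet`. [folklore] -/
theorem mem_instantSet {y : Config N d X} {u : ℝ} :
    u ∈ instantSet G W ε y ↔ 0 ≤ u ∧ ∃ k, 0 < k ∧ eventInstant G W ε y k = ENNReal.ofReal u :=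
  Iff.rfl


open Classical in
/-- The choice made by the event resolution, as a function of the SETS of incoming pairs and of
incoming wall contacts. [folklore] -/
def jumpMap (G : Geometry d X) (W : ι → Wall d X) (S : Set (Fin N × Fin N) × Set (Fin N × ι))
    (w : Config N d X) : Config N d X :=
  if h : S.1.Nonempty then collidePair G h.some.1 h.some.2 w
  else if h' : S.2.Nonempty then reflectWall (W h'.some.2) h'.some.1 w else w


variable (G W ε) in
/-- **Forward regularity up to time `T`** of the event-by-event confined dynamics started at `z`
(the time-`T` truncation of `FwdGood`; GST 2013 Prop. 4.1.1 with `t ∈ [0, T]`, CIP 1994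
Thm. 4.2.1): (i) every free flight ending at an instant `t_{k+1} ≤ T` ends in a simple event
configuration; (ii) strictly inside the free flights and up to time `T` no pair is in contact
and no sphere touches a wall; (iii) some event instant exceeds `T`. Meaningful for `T ≥ 0`. [cite: GST2013, Prop. 4.1.1 p. 19] -/
def FwdGoodUpTo (T : ℝ) (z : Config N d X) : Prop :=
  (∀ k, eventInstant G W ε z (k + 1) ≤ ENNReal.ofReal T →
      IsSimpleEvent G W ε
        (freeFlight G (exitTime G W ε (stateAfter G W ε z k)).toReal (stateAfter G W ε z k))) ∧
  (∀ k (t : ℝ), 0 < t → ENNReal.ofReal t < exitTime G W ε (stateAfter G W ε z k) →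
      eventInstant G W ε z k + ENNReal.ofReal t ≤ ENNReal.ofReal T →
      (∀ i j : Fin N, i ≠ j → freeFlight G t (stateAfter G W ε z k) ∉ contactSet G N ε i j) ∧
      ∀ (i : Fin N) (k' : ι), (freeFlight G t (stateAfter G W ε z k) i).1 ∉ (W k').contact) ∧
  (∃ k, ENNReal.ofReal T < eventInstant G W ε z k)


end General

/-! ## Objects of the short-time analysis on the torus among round scatterers -/

section TorusObjects

variable {d : Type*} [Fintype d] {N : ℕ} {ι : Type*}

variable (N) in
/-- All spheres are *far from all scatterers*: `‖x_i - c_k‖ > ρ + r`. [folklore] -/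
def wallFar (ctr : ι → UnitAddTorus d) (ρ r : ℝ) : Set (Config N d (UnitAddTorus d)) :=
  {z | ∀ (i : Fin N) (k : ι), ρ + r < ‖(Torus.geometry d).sepVec (z i).1 (ctr k)‖}

/-- All sphere–scatterer pairs other than `q = (i, k)` are far. [folklore] -/
def WallOthersFar (ctr : ι → UnitAddTorus d) (ρ r : ℝ) (z : Config N d (UnitAddTorus d))
    (q : Fin N × ι) : Prop :=
  ∀ q' : Fin N × ι, q' ≠ q → ρ + r < ‖(Torus.geometry d).sepVec (z q'.1).1 (ctr q'.2)‖

variable (N) in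
/-- The *wall no-hit piece* of `q = (i, k)`: all pairs far, the other sphere–scatterer pairs
far, sphere `i` close to scatterer `k` (`ρ < ‖q‖ ≤ ρ + r`) and its free motion `q + t v`
does not reach distance `ρ` within time `δ`. [folklore] -/
def wallNoHitPiece (ctr : ι → UnitAddTorus d) (ε ρ r δ : ℝ) (q : Fin N × ι) :
    Set (Config N d (UnitAddTorus d)) :=
  {z | z ∈ Alexander.farSet N ε r ∧ WallOthersFar ctr ρ r z q ∧
    ρ < ‖(Torus.geometry d).sepVec (z q.1).1 (ctr q.2)‖ ∧
    ‖(Torus.geometry d).sepVec (z q.1).1 (ctr q.2)‖ ≤ ρ + r ∧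
    (¬ PairHits ρ ((Torus.geometry d).sepVec (z q.1).1 (ctr q.2)) (z q.1).2 ∨
      δ < pairHitTime ρ ((Torus.geometry d).sepVec (z q.1).1 (ctr q.2)) (z q.1).2)}

variable (N) in
/-- The *wall hit piece* of `q = (i, k)`: all pairs far, the other sphere–scatterer pairs far,
sphere `i` close to scatterer `k`, and its free motion hits the exclusion sphere non-grazingly
(`billiardGood ρ`) at a time `τ₀ ≤ δ`. [folklore] -/
def wallHitPiece (ctr : ι → UnitAddTorus d) (ε ρ r δ : ℝ) (q : Fin N × ι) :
    Set (Config N d (UnitAddTorus d)) :=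
  {z | z ∈ Alexander.farSet N ε r ∧ WallOthersFar ctr ρ r z q ∧
    ‖(Torus.geometry d).sepVec (z q.1).1 (ctr q.2)‖ ≤ ρ + r ∧
    ((Torus.geometry d).sepVec (z q.1).1 (ctr q.2), (z q.1).2) ∈
      (billiardGood ρ : Set (EuclideanSpace ℝ d × EuclideanSpace ℝ d)) ∧
    pairHitTime ρ ((Torus.geometry d).sepVec (z q.1).1 (ctr q.2)) (z q.1).2 ≤ δ}

variable (N) in
/-- The **confined short-time good set**: short-time good for the pairs with all scatterers far,
or exactly one close sphere–scatterer pair (all pairs far) which either does not hit within `δ`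
or hits non-grazingly within `δ`. [cite: GST2013, proof of Prop. 4.1.1 p. 19] -/
def cShortGood (ctr : ι → UnitAddTorus d) (ε ρ r δ : ℝ) : Set (Config N d (UnitAddTorus d)) :=
  (Alexander.shortGood N ε r δ ∩ wallFar N ctr ρ r) ∪
    ⋃ q : Fin N × ι, (wallNoHitPiece N ctr ε ρ r δ q ∪ wallHitPiece N ctr ε ρ r δ q)


/-- The one-particle data of sphere `i` relative to the centre `c`: minimal-image separation
vector and velocity. [folklore] -/
def wallData (c : UnitAddTorus d) (a : UnitAddTorus d × EuclideanSpace ℝ d) :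
    EuclideanSpace ℝ d × EuclideanSpace ℝ d :=
  ((Torus.geometry d).sepVec a.1 c, a.2)

/-- **The one-particle billiard map at the round scatterer of exclusion radius `ρ` centred at
`c`** (the billiard `billiardMap ρ` of `HardSphereBilliard` in torus coordinates centred at `c`):
`x ↦ x + τ₀ (v - v')`, `v ↦ v'` with `τ₀` the hitting time and `v'` the specularly reflected
velocity — flow freely to the scatterer, reflect, flow freely back, so that the dynamics over a
window `[0, δ] ∋ τ₀` with exactly this reflection is `S_δ ∘ wallKickOne`. Junk outside the wall
hit pieces. [cite: CIP1994, App. 4.A p. 111] -/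
def wallKickOne (ρ : ℝ) (c : UnitAddTorus d) (a : UnitAddTorus d × EuclideanSpace ℝ d) :
    UnitAddTorus d × EuclideanSpace ℝ d :=
  (a.1 + FunctionSpaces.Torus.proj (pairHitTime ρ (wallData c a).1 a.2 • (a.2 - hitVel ρ (wallData c a))),
    hitVel ρ (wallData c a))

/-- **The wall kick of the window**: `wallKickOne` applied to sphere `q.1` at the scatterer `q.2`. [folklore] -/
def wallCollide (ρ : ℝ) (ctr : ι → UnitAddTorus d) (q : Fin N × ι) (z : Config N d (UnitAddTorus d)) :
    Config N d (UnitAddTorus d) :=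
  update z q.1 (wallKickOne ρ (ctr q.2) (z q.1))


/-- The standing hypotheses of the one-reflection analysis of `q = (i, k)` over `[0, δ]`: sphere
diameter `0 < ε < 1/2`, exclusion radius `ρ > 0` with chart room `ρ + 2r < 1/2`, displacement
room `2Vδ ≤ r`, energy shell `E(z) ≤ V²/2` (`V ≥ 0`), and `z` in the wall hit piece of `q`. [folklore] -/
structure WallHitHyp (ctr : ι → UnitAddTorus d) (ε ρ r δ V : ℝ) (z : Config N d (UnitAddTorus d))
    (q : Fin N × ι) : Prop where
  /-- The diameter is positive. -/
  ε_pos : 0 < ε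
  /-- Room for the charts of the pairs (only `ε < 1/2` is used). -/
  chartε : ε + 2 * r < 2⁻¹
  /-- The exclusion radius is positive. -/
  ρ_pos : 0 < ρ
  /-- Room for the chart of the interacting sphere–scatterer pair. -/
  chart : ρ + 2 * r < 2⁻¹
  /-- Displacements during the window are at most `r/2` per particle. -/
  window : 2 * V * δ ≤ r
  /-- The speed bound is nonnegative. -/
  V_nonneg : 0 ≤ V
  /-- The datum lies on the energy shell of the speed bound. -/
  energy : configEnergy z ≤ V ^ 2 / 2
  /-- The datum lies in the wall hit piece of `q`. -/
  mem : z ∈ wallHitPiece N ctr ε ρ r δ q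


open Classical in
variable (N) in
/-- **The one-step event map of the window** ("kick") for the confined dynamics: `pairCollide`
on a pair hit piece with all scatterers far, `wallCollide` on a wall hit piece, the identity
elsewhere; on the confined short-time good set the confined flow at time `δ` is `S_δ ∘ cKick`
(`fwdFlow_eq_freeFlight_cKick`). [folklore] -/
def cKick (ctr : ι → UnitAddTorus d) (ε ρ r δ : ℝ) (z : Config N d (UnitAddTorus d)) : Config N d (UnitAddTorus d) :=
  if h : ∃ p : Fin N × Fin N, p.1 < p.2 ∧ z ∈ Alexander.hitPiece N ε r δ p.1 p.2 ∧ z ∈ wallFar N ctr ρ r then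
    Alexander.pairCollide ε h.choose.1 h.choose.2 z
  else if h' : ∃ q : Fin N × ι, z ∈ wallHitPiece N ctr ε ρ r δ q then wallCollide ρ ctr h'.choose z
  else z


/-- The *no-event data* of the confined short-time good set: far or no-hit for the pairs with all
scatterers far, or a wall no-hit piece. [folklore] -/
def IsNoEventData (ctr : ι → UnitAddTorus d) (ε ρ r δ : ℝ) (z : Config N d (UnitAddTorus d)) : Prop :=
  ((z ∈ Alexander.farSet N ε r ∨ ∃ p : Fin N × Fin N, p.1 < p.2 ∧ z ∈ Alexander.noHitPiece N ε r δ p.1 p.2) ∧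
      z ∈ wallFar N ctr ρ r) ∨
    ∃ q : Fin N × ι, z ∈ wallNoHitPiece N ctr ε ρ r δ q


variable (N) in
/-- Sphere `q.1` is `r`-close to the scatterer `q.2`: `ρ ≤ ‖x - c‖_{T^d} ≤ ρ + r`. [cite: GST2013, Lemma 4.1.2] -/
def wallClose (ctr : ι → UnitAddTorus d) (ρ r : ℝ) (q : Fin N × ι) : Set (Config N d (UnitAddTorus d)) :=
  {z | ρ ≤ ‖(Torus.geometry d).sepVec (z q.1).1 (ctr q.2)‖ ∧ ‖(Torus.geometry d).sepVec (z q.1).1 (ctr q.2)‖ ≤ ρ + r}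


variable (N) in
/-- The *wall-bad set*: a sphere on a scatterer, or two distinct close sphere–scatterer events, or
a close sphere–scatterer event together with a close pair, or a grazing sphere–scatterer motion
(vanishing discriminant, nonzero velocity) — the null-or-thin events of the sphere–scatterer
part of the short-time analysis (GST 2013 Lemma 4.1.2, with the boundary). [cite: GST2013, Lemma 4.1.2] -/
def wallBad (ctr : ι → UnitAddTorus d) (ε ρ r : ℝ) : Set (Config N d (UnitAddTorus d)) :=
  (⋃ q : Fin N × ι, {z | ‖(Torus.geometry d).sepVec (z q.1).1 (ctr q.2)‖ = ρ}) ∪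
  (⋃ qq : (Fin N × ι) × (Fin N × ι), {z | qq.1 ≠ qq.2 ∧ z ∈ wallClose N ctr ρ r qq.1 ∩ wallClose N ctr ρ r qq.2}) ∪
  (⋃ qp : (Fin N × ι) × (Fin N × Fin N), {z | qp.2.1 ≠ qp.2.2 ∧ z ∈ wallClose N ctr ρ r qp.1 ∩ closePair N d ε r qp.2.1 qp.2.2}) ∪
  (⋃ q : Fin N × ι, {z | pairDisc ρ ((Torus.geometry d).sepVec (z q.1).1 (ctr q.2)) (z q.1).2 = 0 ∧ (z q.1).2 ≠ 0})


/-- Translation of the position by `c`: `(x, v) ↦ (x + c, v)`. [folklore] -/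
def shiftPos (c : UnitAddTorus d) (a : UnitAddTorus d × EuclideanSpace ℝ d) : UnitAddTorus d × EuclideanSpace ℝ d :=
  (a.1 + c, a.2)


/-- The good domain of the wall kick at the centre `c` with chart bound `ρc`: the shifted datum is
in the good domain of the one-particle billiard. [folklore] -/
def wallKickGood (ρ ρc : ℝ) (c : UnitAddTorus d) : Set (UnitAddTorus d × EuclideanSpace ℝ d) :=
  shiftPos (-c) ⁻¹' Alexander.phaseGood ρ ρc


variable (N) in
/-- The pieces of the confined short-time good set indexed by a finite type: a pair piece with all
scatterers far, or a wall no-hit / hit piece. [folklore] -/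
def cShortPiece (ctr : ι → UnitAddTorus d) (ε ρ r δ : ℝ) :
    Option ((Fin N × Fin N) × Bool) ⊕ ((Fin N × ι) × Bool) → Set (Config N d (UnitAddTorus d))
  | Sum.inl κ => Alexander.shortPiece N ε r δ κ ∩ wallFar N ctr ρ r
  | Sum.inr (q, false) => wallNoHitPiece N ctr ε ρ r δ q
  | Sum.inr (q, true) => wallHitPiece N ctr ε ρ r δ q


variable (N) in
/-- The data of the energy shell `E ≤ V²/2` that are confined-short-time good (window `δ`,
interaction length `2Vδ`) together with their images under the confined flow at the times
`δ, 2δ, …, mδ`. [cite: GST2013, proof of Prop. 4.1.1 p. 19] -/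
def iterGood (ctr : ι → UnitAddTorus d) (ρ : ℝ) (W : ι → Wall d (UnitAddTorus d)) (ε δ V : ℝ) (m : ℕ) :
    Set (Config N d (UnitAddTorus d)) :=
  {z | configEnergy z ≤ V ^ 2 / 2 ∧ z ∈ cShortGood N ctr ε ρ (2 * V * δ) δ ∧
    ∀ k : ℕ, k < m → fwdFlow (Torus.geometry d) W ε z (((k : ℝ) + 1) * δ) ∈ cShortGood N ctr ε ρ (2 * V * δ) δ}


variable (N ι) in
/-- The bound for the volume lost in one window:
`(N⁴ + |(N×ι)²| + |(N×ι)×N²|) (d · 2Vδ · vol B₁)² vol(B̄_V)^N`. [folklore] -/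
def windowLoss (δ V : ℝ) : ℝ≥0∞ :=
  ((N : ℝ≥0∞) ^ 4 + ((Nat.card ((Fin N × ι) × (Fin N × ι)) : ℝ≥0∞) + (Nat.card ((Fin N × ι) × (Fin N × Fin N)) : ℝ≥0∞))) *
    ((ENNReal.ofReal (Fintype.card d * (2 * V * δ)) * volume (Metric.ball (0 : EuclideanSpace ℝ d) 1)) ^ 2 *
      volume (Metric.closedBall (0 : EuclideanSpace ℝ d) V) ^ N)


variable (N ι) in
/-- The constant of the window loss: `windowLoss δ V = K(V) · δ²`. [folklore] -/
def windowConst (V : ℝ) : ℝ≥0∞ :=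
  ((N : ℝ≥0∞) ^ 4 + ((Nat.card ((Fin N × ι) × (Fin N × ι)) : ℝ≥0∞) + (Nat.card ((Fin N × ι) × (Fin N × Fin N)) : ℝ≥0∞))) *
    ((ENNReal.ofReal (Fintype.card d * (2 * V)) * volume (Metric.ball (0 : EuclideanSpace ℝ d) 1)) ^ 2 *
      volume (Metric.closedBall (0 : EuclideanSpace ℝ d) V) ^ N)


end TorusObjects

end ConfinedAlexander

end Kinetic

end

end Literature.Analysis.FluidPDE
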